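import Summits.CriticalPhenomena.Ising3DConformalLimit.Theorems.MoebiusLimitExists.Negative.CompactnessContent
import Summits.CriticalPhenomena.Ising3DConformalLimit.Theorems.MoebiusLimitExists.Negative.AxisRatioRegularity
import Literature.Analysis.Convex.LogConvexSequenceChord
import HarnessLib

/-!
# Sub-goal `clusterPoint_isNondegenerateTwoPoint` of crux `ReflectionTwin.ExistsContinuousLimit`
# (stmt-CriticalPhenomena-4582), line `Sketch`: every cluster point of the pinned zoom is non-degenerate

Support file for the crux `ReflectionTwin.ExistsContinuousLimit` (item stmt-CriticalPhenomena-4582), line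
`Sketch`: the registered by-name sub-goal `clusterPoint_isNondegenerateTwoPoint` — UNCONDITIONALLY, every
cluster point `S` of the pinned zoom of the critical `ℤ³` spin correlators (`IsClusterPoint S`: along some
mesh sequence `u_k → 0⁺`, `ρ_pin(u_k)ⁿ ⟨∏ σ_{[xᵢ/u_k]}⟩_{β_c} → S n x` locally uniformly off the diagonals,
`ρ_pin(δ) = ⟨σ₀σ_{⌊1/δ⌋e₀}⟩^{-1/2}`) has `S₂ > 0` on every non-coincident pair. The tree had this only
under the compactness hypothesis of `stub_compactness`
(`MoebiusLimitExistsNegative.clusterPoint_nondeg_of_compactness`); here the compactness hypothesis is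
removed, using only the TWO-POINT cluster datum.

Proof.
* `criticalTwoPoint_axis_ratio_ge_pow` (lattice, no limit): for naturals `L < N ≤ M` with
  `M − N ≤ K (N − L)` and `0 ≤ a ≤ 1`, `a ≤ g(N)/g(L)`, where `g(n) = ⟨σ₀σ_{n e₀}⟩_{β_c}` on `ℤ³`, one has
  `a ^ K ≤ g(M)/g(N)`. This is the chord bound for the LOG-CONVEX sequence `g`
  (`AxisRatioRegularity.criticalTwoPoint_axis_logConvex`, reflection positivity at `m*(β_c) = 0`;
  `Literature.Analysis.Convex.pow_le_pow_mul_pow_of_logConvexOn'`): `g(N)^{M−L} ≤ g(L)^{M−N} g(M)^{N−L}`,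
  i.e. `(g N/g L)^{M−N} ≤ (g M/g N)^{N−L}`, and `(a^K)^{N−L} = a^{K(N−L)} ≤ a^{M−N} ≤ (g N/g L)^{M−N}`.
* `clusterPoint_axis_pos_of_one_le`: for `t ≥ 1`, `S₂(0, t e₀) > 0`. At mesh `δ = u_k ≤ 1/4` put
  `x = 1/δ`, `L = ⌊x/2⌋`, `N = ⌊x⌋`, `M = ⌊t x⌋`, `K = ⌈4t⌉`; then `L < N ≤ M`, `M − N ≤ K (N − L)`
  (`floor_bookkeeping`), the pinned zoom at `(0, t e₀)` is `g(M)/g(N)` and at `(0, e₀/2)` it is `g(L)/g(N)`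
  (`pinnedZoom_axisPair`). The latter converges to `s = S₂(0, e₀/2) ≥ 0`, so eventually it is `≤ s + 1`,
  i.e. `g(N)/g(L) ≥ a := (s+1)⁻¹ ∈ (0, 1]`; hence eventually the zoom at `(0, t e₀)` is `≥ a^K`, and so is
  its limit `S₂(0, t e₀)`.
* `clusterPoint_isNondegenerateTwoPoint`: for a non-coincident pair `x` put `t = 3‖x₀ − x₁‖_∞ + 1 ≥ 1`; the
  inward Messager–Miracle-Solé comparison along the mesh sequence
  (`clusterPoint_two_le_of_mul_norm_lt`) gives `S₂ x ≥ S₂(0, t e₀) > 0`.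

References: M. Aizenman, H. Duminil-Copin, Ann. of Math. 194 (2021), Prop. 5.3 (log-convexity along the axis,
through the tree theorem `criticalTwoPoint_axis_logConvex`); A. Messager, S. Miracle-Solé, J. Stat. Phys. 17
(1977) (monotonicity, through the tree theorem `clusterPoint_two_le_of_mul_norm_lt`). No definitions are
introduced.
-/

noncomputable section

namespace Summit.CriticalPhenomena.Ising3DConformalLimit.ReflectionTwinExistsContinuousLimit

open Filter Set
open scoped Topology
open Literature.Probability.LatticeModels
open Summit.CriticalPhenomena.Ising3DConformalLimit.MoebiusLimitExistsOnlyInteraction (rhoPin IsClusterPoint)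
open Summit.CriticalPhenomena.Ising3DConformalLimit.MoebiusLimitExistsNegative
  (pinnedZoom_axisPair clusterPoint_two_conv clusterPoint_two_nonneg clusterPoint_two_le_of_mul_norm_lt)
open Summit.CriticalPhenomena.Ising3DConformalLimit.AxisRatioRegularity (criticalTwoPoint_axis_logConvex)

/-! ### The lattice input: a chord bound for the log-convex axis two-point function -/

/-- **Chord bound for the critical axis two-point function `g(n) = ⟨σ₀σ_{n e₀}⟩_{β_c}` on `ℤ³`.** For
naturals `L < N ≤ M` with `M − N ≤ K · (N − L)` and a real `0 ≤ a ≤ 1` with `a ≤ g(N)/g(L)`: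
`a ^ K ≤ g(M)/g(N)`. (Log-convexity of `g`, Aizenman–Duminil-Copin 2021 Prop. 5.3 via
`criticalTwoPoint_axis_logConvex`, in the chord form `g(N)^{M−L} ≤ g(L)^{M−N} g(M)^{N−L}`.) [folklore] -/
theorem criticalTwoPoint_axis_ratio_ge_pow {L N M K : ℕ} (hLN : L < N) (hNM : N ≤ M)
    (hK : M - N ≤ K * (N - L)) {a : ℝ} (ha0 : 0 ≤ a) (ha1 : a ≤ 1)
    (haNL : a ≤ criticalTwoPoint 3 (Pi.single 0 (N : ℤ)) / criticalTwoPoint 3 (Pi.single 0 (L : ℤ))) :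
    a ^ K ≤ criticalTwoPoint 3 (Pi.single 0 (M : ℤ)) / criticalTwoPoint 3 (Pi.single 0 (N : ℤ)) := by
  obtain ⟨g, hg⟩ : ∃ g : ℕ → ℝ, ∀ n, g n = criticalTwoPoint 3 (Pi.single 0 (n : ℤ)) := ⟨_, fun _ => rfl⟩
  have hpos : ∀ n, 0 < g n := fun n => by rw [hg]; exact criticalTwoPoint_axis_pos n
  have hch : g N ^ (M - L) ≤ g L ^ (M - N) * g M ^ (N - L) :=
    Literature.Analysis.Convex.pow_le_pow_mul_pow_of_logConvexOn' (f := g) (n₀ := L) (N := M)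
      (fun n _ _ => (hpos n).le)
      (fun n _ _ => by rw [hg, hg, hg]; exact criticalTwoPoint_axis_logConvex n) hLN.le hNM
  rw [← hg, ← hg] at haNL
  rw [← hg, ← hg]
  have h1 : (g N / g L) ^ (M - N) ≤ (g M / g N) ^ (N - L) := by
    rw [div_pow, div_pow, div_le_div_iff₀ (pow_pos (hpos L) _) (pow_pos (hpos N) _)]
    calc g N ^ (M - N) * g N ^ (N - L) = g N ^ (M - L) := by
          rw [← pow_add]; congr 1; omega
      _ ≤ g L ^ (M - N) * g M ^ (N - L) := hch
      _ = g M ^ (N - L) * g L ^ (M - N) := mul_comm _ _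
  have h2 : (a ^ K) ^ (N - L) ≤ (g M / g N) ^ (N - L) :=
    calc (a ^ K) ^ (N - L) = a ^ (K * (N - L)) := by rw [pow_mul]
      _ ≤ a ^ (M - N) := pow_le_pow_of_le_one ha0 ha1 hK
      _ ≤ (g N / g L) ^ (M - N) := pow_le_pow_left₀ ha0 haNL _
      _ ≤ (g M / g N) ^ (N - L) := h1
  exact le_of_pow_le_pow_left₀ (by omega) (div_pos (hpos M) (hpos N)).le h2

/-! ### Floor bookkeeping at one mesh -/

/-- Floor bookkeeping: for `x ≥ 4` and `t ≥ 1`, with `L = ⌊x/2⌋₊`, `N = ⌊x⌋₊`, `M = ⌊t x⌋₊`, `K = ⌈4t⌉₊`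
one has `L < N ≤ M` and `M − N ≤ K (N − L)`. [folklore] -/
private theorem floor_bookkeeping {x t : ℝ} (hx : 4 ≤ x) (ht : 1 ≤ t) :
    ⌊x / 2⌋₊ < ⌊x⌋₊ ∧ ⌊x⌋₊ ≤ ⌊t * x⌋₊ ∧
      ⌊t * x⌋₊ - ⌊x⌋₊ ≤ ⌈4 * t⌉₊ * (⌊x⌋₊ - ⌊x / 2⌋₊) := by
  have hx0 : 0 ≤ x := by linarith
  have hL : (⌊x / 2⌋₊ : ℝ) ≤ x / 2 := Nat.floor_le (by linarith)
  have hN : x < (⌊x⌋₊ : ℝ) + 1 := Nat.lt_floor_add_one x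
  have hM : (⌊t * x⌋₊ : ℝ) ≤ t * x := Nat.floor_le (by positivity)
  have hK : (4 : ℝ) * t ≤ (⌈4 * t⌉₊ : ℝ) := Nat.le_ceil _
  have hLN : ⌊x / 2⌋₊ < ⌊x⌋₊ := by
    have h : (⌊x / 2⌋₊ : ℝ) < ⌊x⌋₊ := by linarith
    exact_mod_cast h
  have hNM : ⌊x⌋₊ ≤ ⌊t * x⌋₊ := Nat.floor_le_floor (le_mul_of_one_le_left hx0 ht)
  refine ⟨hLN, hNM, ?_⟩
  have hNL0 : (0 : ℝ) ≤ (⌊x⌋₊ : ℝ) - ⌊x / 2⌋₊ := by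
    have : ((⌊x / 2⌋₊ : ℕ) : ℝ) ≤ ((⌊x⌋₊ : ℕ) : ℝ) := by exact_mod_cast hLN.le
    linarith
  have h1 : (4 : ℝ) * t * ((⌊x⌋₊ : ℝ) - ⌊x / 2⌋₊) ≤ (⌈4 * t⌉₊ : ℝ) * ((⌊x⌋₊ : ℝ) - ⌊x / 2⌋₊) :=
    mul_le_mul_of_nonneg_right hK hNL0
  have h2 : (4 : ℝ) * t * (x / 2 - 1) ≤ 4 * t * ((⌊x⌋₊ : ℝ) - ⌊x / 2⌋₊) :=
    mul_le_mul_of_nonneg_left (by linarith) (by positivity)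
  have h5 : (t + 1) * 4 ≤ (t + 1) * x := mul_le_mul_of_nonneg_left hx (by linarith)
  have h3 : ((⌊t * x⌋₊ : ℕ) : ℝ) - ⌊x⌋₊ ≤ (⌈4 * t⌉₊ : ℝ) * ((⌊x⌋₊ : ℝ) - ⌊x / 2⌋₊) := by
    linarith
  have h4 : ((⌊t * x⌋₊ - ⌊x⌋₊ : ℕ) : ℝ) ≤ ((⌈4 * t⌉₊ * (⌊x⌋₊ - ⌊x / 2⌋₊) : ℕ) : ℝ) := by
    rw [Nat.cast_sub hNM, Nat.cast_mul, Nat.cast_sub hLN.le]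
    exact h3
  exact_mod_cast h4

/-! ### Axis positivity of every cluster point, unconditionally -/

/-- **Every cluster point of the two-point pinned zoom is positive on the axis beyond the pin:**
`S₂(0, t e₀) > 0` for all `t ≥ 1`, with NO compactness hypothesis (compare
`MoebiusLimitExistsNegative.clusterPoint_axis_pos_of_compactness`). At mesh `δ = u_k ≤ 1/4`, with
`x = 1/δ`, the zoom at `(0, t e₀)` is `g(⌊tx⌋)/g(⌊x⌋)` and at `(0, e₀/2)` it is `g(⌊x/2⌋)/g(⌊x⌋) → s ≥ 0`;
the chord bound `criticalTwoPoint_axis_ratio_ge_pow` then gives, eventually, zoom`(0, t e₀) ≥ (s+1)^{-⌈4t⌉}`,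
and the bound passes to the limit. [folklore] -/
theorem clusterPoint_axis_pos_of_one_le {S : CorrFamily 3}
    (hS : ∃ u : ℕ → ℝ, Tendsto u atTop (𝓝[>] (0 : ℝ)) ∧
      TendstoLocallyUniformlyOn (fun k => rescaledCorrelator (criticalCorr 3) rhoPin 2 (u k)) (S 2)
        atTop (NonCoincident 3 2)) {t : ℝ} (ht : 1 ≤ t) :
    0 < S 2 ![0, EuclideanSpace.single 0 t] := by
  have hs0 : 0 ≤ S 2 ![0, EuclideanSpace.single 0 (1 / 2 : ℝ)] :=
    clusterPoint_two_nonneg hS (zero_unitVec_mem_nonCoincident (by norm_num))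
  obtain ⟨u, hu, hconv⟩ := hS
  obtain ⟨s, hs⟩ : ∃ s : ℝ, s = S 2 ![0, EuclideanSpace.single 0 (1 / 2 : ℝ)] := ⟨_, rfl⟩
  rw [← hs] at hs0
  -- the zoom at `(0, e₀/2)` converges to `s`, hence is eventually `≤ s + 1`
  have h_half : Tendsto (fun k => rescaledCorrelator (criticalCorr 3) rhoPin 2 (u k)
      ![0, EuclideanSpace.single 0 (1 / 2 : ℝ)]) atTop (𝓝 s) := by
    rw [hs]; exact hconv.tendsto_at (zero_unitVec_mem_nonCoincident (by norm_num))
  have hev_half : ∀ᶠ k in atTop, rescaledCorrelator (criticalCorr 3) rhoPin 2 (u k)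
      ![0, EuclideanSpace.single 0 (1 / 2 : ℝ)] ≤ s + 1 :=
    h_half.eventually (eventually_le_nhds (lt_add_one s))
  have hu4 : ∀ᶠ k in atTop, u k ∈ Set.Ioc (0:ℝ) (1 / 4) :=
    hu.eventually (Ioc_mem_nhdsGT (by norm_num))
  -- the constants of the lower bound `a ^ K`
  obtain ⟨a, ha⟩ : ∃ a : ℝ, a = (s + 1)⁻¹ := ⟨_, rfl⟩
  have ha0 : 0 < a := by rw [ha]; exact inv_pos.2 (by linarith)
  have ha1 : a ≤ 1 := by rw [ha]; exact inv_le_one_of_one_le₀ (by linarith)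
  have h_t : Tendsto (fun k => rescaledCorrelator (criticalCorr 3) rhoPin 2 (u k)
      ![0, EuclideanSpace.single 0 t]) atTop (𝓝 (S 2 ![0, EuclideanSpace.single 0 t])) :=
    hconv.tendsto_at (zero_unitVec_mem_nonCoincident (by linarith : t ≠ 0))
  refine lt_of_lt_of_le (pow_pos ha0 ⌈4 * t⌉₊) (ge_of_tendsto h_t ?_)
  filter_upwards [hev_half, hu4] with k hk hδ
  -- bookkeeping at the mesh `δ = u k ∈ (0, 1/4]`, `x = 1/δ ≥ 4`
  have hδ0 : 0 < u k := hδ.1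
  have hδ1 : u k ∈ Set.Ioc (0:ℝ) 1 := ⟨hδ.1, hδ.2.trans (by norm_num)⟩
  obtain ⟨x, hx⟩ : ∃ x : ℝ, x = 1 / u k := ⟨_, rfl⟩
  have hx4 : 4 ≤ x := by rw [hx, le_div_iff₀ hδ0]; linarith [hδ.2]
  have hx0 : 0 ≤ x := by linarith
  obtain ⟨hLN, hNM, hKb⟩ := floor_bookkeeping hx4 ht
  have e_t : ⌊t / u k⌋ = ((⌊t * x⌋₊ : ℕ) : ℤ) := by
    rw [show t / u k = t * x by rw [hx]; ring]
    exact (Int.natCast_floor_eq_floor (by positivity)).symm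
  have e_1 : ⌊1 / u k⌋ = ((⌊x⌋₊ : ℕ) : ℤ) := by
    rw [← hx]; exact (Int.natCast_floor_eq_floor hx0).symm
  have e_h : ⌊(1 / 2 : ℝ) / u k⌋ = ((⌊x / 2⌋₊ : ℕ) : ℤ) := by
    rw [show (1 / 2 : ℝ) / u k = x / 2 by rw [hx]; ring]
    exact (Int.natCast_floor_eq_floor (by positivity)).symm
  rw [pinnedZoom_axisPair hδ1 t, e_t, e_1]
  rw [pinnedZoom_axisPair hδ1 (1 / 2 : ℝ), e_h, e_1] at hk
  refine criticalTwoPoint_axis_ratio_ge_pow hLN hNM hKb ha0.le ha1 ?_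
  -- `a ≤ g N / g L = (g L / g N)⁻¹`, from `g L / g N ≤ s + 1`
  rw [← inv_div, ha]
  exact inv_anti₀ (div_pos (criticalTwoPoint_axis_pos _) (criticalTwoPoint_axis_pos _)) hk

/-- **Every cluster point of the two-point pinned zoom is non-degenerate** (`S₂ > 0` on all
non-coincident pairs), unconditionally: axis positivity beyond the pin
(`clusterPoint_axis_pos_of_one_le`) plus the inward Messager–Miracle-Solé comparison along the mesh
sequence (`clusterPoint_two_le_of_mul_norm_lt`) at `t = 3‖x₀ − x₁‖_∞ + 1`. [folklore] -/
theorem clusterPoint_nondeg_two {S : CorrFamily 3}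
    (hS : ∃ u : ℕ → ℝ, Tendsto u atTop (𝓝[>] (0 : ℝ)) ∧
      TendstoLocallyUniformlyOn (fun k => rescaledCorrelator (criticalCorr 3) rhoPin 2 (u k)) (S 2)
        atTop (NonCoincident 3 2)) : IsNondegenerateTwoPoint S := by
  intro x hx
  obtain ⟨t, ht⟩ : ∃ t : ℝ, t = 3 * ‖WithLp.ofLp (x 0) - WithLp.ofLp (x 1)‖ + 1 := ⟨_, rfl⟩
  have ht1 : 1 ≤ t := by rw [ht]; linarith [norm_nonneg (WithLp.ofLp (x 0) - WithLp.ofLp (x 1))]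
  have ht0 : 0 < t := by linarith
  have hpos := clusterPoint_axis_pos_of_one_le hS ht1
  refine lt_of_lt_of_le hpos
    (clusterPoint_two_le_of_mul_norm_lt hS hx (zero_unitVec_mem_nonCoincident ht0.ne') ?_)
  rw [MoebiusLimitExistsNegative.norm_axisPair_sub, abs_of_pos ht0, ht]
  linarith

/-- **Registered sub-goal `clusterPoint_isNondegenerateTwoPoint` (crux stmt-CriticalPhenomena-4582, line
`Sketch`): every cluster point of the pinned zoom of the critical `ℤ³` correlators is non-degenerate**,
`IsClusterPoint S → IsNondegenerateTwoPoint S`, with no compactness or two-point-law hypothesis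
(`clusterPoint_nondeg_two` on the two-point cluster datum `clusterPoint_two_conv`). It discharges the
hypothesis of `orbitPrecompact_of_seqCompact` and strengthens `clusterPoint_nondeg_of_compactness`.
[folklore] -/
theorem clusterPoint_isNondegenerateTwoPoint : ∀ S : Literature.Probability.LatticeModels.CorrFamily 3, Summit.CriticalPhenomena.Ising3DConformalLimit.MoebiusLimitExistsOnlyInteraction.IsClusterPoint S → Literature.Probability.LatticeModels.IsNondegenerateTwoPoint S :=
  fun _ hS => clusterPoint_nondeg_two (clusterPoint_two_conv hS)

end Summit.CriticalPhenomena.Ising3DConformalLimit.ReflectionTwinExistsContinuousLimit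

end
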